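import Mathlib
import Summits.MatrixMultiplication.MatrixMultiplication.Theorems.SnSubsetDichotomyPolynomialSlackFiveEighths
import Summits.MatrixMultiplication.MatrixMultiplication.Theorems.SnSubsetDichotomyPolynomialSlackTrichotomyRanges
import Summits.MatrixMultiplication.MatrixMultiplication.Theorems.SnSubsetDichotomyPolynomialSlackStructureTrichotomy

/-!
# The 3/4 step: the crux inequality for every exponent `C < 3/4`

Crux `Summit.MatrixMultiplication.MatrixMultiplication.Theses.SnSubsetDichotomy.PolynomialSlack`
(item `stmt-MatrixMultiplication-8306`; `∀ C ∃ n₀ ∀ n ≥ n₀ ∀ TPP S T U ⊆ S_n, |S||T||U|·n^C ≤ (n!)^{3/2}`),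
level-one programme, line transport-split-hull (lead c10, THE 3/4 STEP), registered stub
`slack_of_lt_three_quarters`. The tree had the inequality for every `C < 2/3`
(`slack_of_lt_two_thirds`, file `…TwoThirds`). This file proves it for every `C < 3/4`
(`slack_of_lt_three_quarters`), by the same INDUCTION ON `n` (`P(n)` the maximal TPP volume of `S_n`,
`Q(n) = (n!)^{3/2}/P(n)`, `eventually_le_of_min_le`), now fed by the TRICHOTOMY structure theorem
`pure_violator_volume_le_trichotomy`: a pure violator of `S_n` has volume `≤ n^{1495/1000}·P(n-1)`, so
(purification costing a factor `8 ≤ n^{1/400}`) every induction step gains `n^{1/400}`. The scale is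
chosen adaptively, `M := 10³⁴(1+log n)¹⁸·F²/(n-1)` with `F = n!√(n!)/N' ∈ [√(n-1)/2, 8n^{C₁}]`
(`frobenius_floor`), the cap exponent is `q := 2C₁ < 3/2`, and the side conditions hold for large `n`
when `C₁ < 3/4` (`eventually_sharp_ranges` for the scale, `eventually_trichotomy_ranges` for the
level-one smallness, the cap `2 log F ≤ 2C₁ log n + 5` and the eight ranges `hr1 … hr8`).
-/

namespace Summit.MatrixMultiplication.MatrixMultiplication.Theorems.PolynomialSlack

open scoped BigOperators
open Literature.Combinatorics.Additive (TripleProductProperty)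

-- `Summit.<Summit>.<Problem>` is the tree's mandated summit-side namespace (CONVENTIONS §2); for
-- this single-conjunct summit the two coincide, so each declaration silences `dupNamespace`.
set_option linter.dupNamespace false

set_option maxHeartbeats 1600000 in
/-- **The 3/4 step** (registered sub-goal `slack_of_lt_three_quarters`, the target theorem of the
trichotomy endgame). For every `C < 3/4` there is `n₀` such that every triple `S, T, U ⊆ S_n`
(`n ≥ n₀`) with the triple product property satisfies `|S||T||U|·n^C ≤ (n!)^{3/2}`. Proof: induction
on `n` via `eventually_le_of_min_le` (`P(n)` the maximal TPP volume of `S_n`, `Q(n) = (n!)^{3/2}/P(n)`):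
a violator at `n` is purified (`exists_signPure_half`, factor `8`) and fibred by
`pure_violator_volume_le_trichotomy` (`N' ≤ n^{1495/1000}·P(n-1)`, scale `M = 10³⁴(1+log n)¹⁸F²/(n-1)`,
cap `q = 2C₁`), whose side conditions hold for large `n` by `eventually_sharp_ranges` and
`eventually_trichotomy_ranges`; as `8·n^{1495/1000} ≤ n^{3/2-1/400}` eventually, every step gains
`n^{1/400}`. [folklore] -/
theorem slack_of_lt_three_quarters (C : ℝ) (hC : C < 3 / 4) :
    ∃ n₀ : ℕ, ∀ n ≥ n₀, ∀ S T U : Finset (Equiv.Perm (Fin n)), TripleProductProperty S T U →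
      ((S.card * T.card * U.card : ℕ) : ℝ) * (n : ℝ) ^ C ≤ (n.factorial : ℝ) ^ ((3 : ℝ) / 2) := by
  classical
  /- parameters -/
  obtain ⟨C₁, hC₁⟩ : ∃ C₁ : ℝ, C₁ = (max C 0 + 3 / 4) / 2 := ⟨_, rfl⟩
  have hmax : max C 0 < 3 / 4 := max_lt hC (by norm_num)
  have hCC₁ : C ≤ C₁ := by rw [hC₁]; have := le_max_left C 0; linarith
  have hC₁lt : C₁ < 3 / 4 := by rw [hC₁]; linarith
  have hC₁0 : 0 < C₁ := by rw [hC₁]; have := le_max_right C 0; linarith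
  have hC₁1 : C₁ ≤ 1 := by linarith
  /- thresholds -/
  obtain ⟨na, hna⟩ := eventually_sharp_ranges C₁ hC₁lt
  obtain ⟨nb, hnb⟩ := eventually_trichotomy_ranges C₁ hC₁lt
  obtain ⟨nd, hnd⟩ := eventually_log_pow_mul_rpow_le 0 (1495 / 1000) ((3 : ℝ) / 2 - 1 / 400) 8
    (by norm_num) (by norm_num)
  obtain ⟨nc, hnc⟩ := polynomialSlack_of_lt_half 0 (by norm_num)
  /- the maximal volumes -/
  choose P hP using exists_max_tpp_volume
  have hP1 : ∀ n, (1 : ℝ) ≤ P n := fun n => by exact_mod_cast (hP n).2.2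
  have hP0 : ∀ n, (0 : ℝ) < P n := fun n => lt_of_lt_of_le one_pos (hP1 n)
  have hPle : ∀ n, nc ≤ n → (P n : ℝ) ≤ (n.factorial : ℝ) ^ ((3 : ℝ) / 2) := by
    intro n hn
    obtain ⟨S, T, U, hTPP, hvol⟩ := (hP n).2.1
    have h := hnc n hn S T U hTPP
    rw [Real.rpow_zero, mul_one, hvol] at h
    exact h
  set Q : ℕ → ℝ := fun n => max 1 ((n.factorial : ℝ) ^ ((3 : ℝ) / 2) / P n) with hQ
  have hQ1 : ∀ n, 1 ≤ Q n := fun n => le_max_left _ _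
  have hQe : ∀ n, nc ≤ n → Q n = (n.factorial : ℝ) ^ ((3 : ℝ) / 2) / P n := by
    intro n hn
    rw [hQ]; dsimp only
    exact max_eq_right (by rw [le_div_iff₀ (hP0 n), one_mul]; exact hPle n hn)
  /- the step -/
  set n₁ : ℕ := max (max (max na nb) nd) (nc + 1) with hn₁
  have hstep : ∀ n : ℕ, n₁ ≤ n →
      min (1 * (n : ℝ) ^ C₁) ((n : ℝ) ^ (1 / 400 : ℝ) * Q (n - 1)) ≤ Q n := by
    intro n hn
    have hA : max (max na nb) nd ≤ n := le_trans (le_max_left _ _) hn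
    have hna' : na ≤ n := le_trans (le_trans (le_max_left _ _) (le_max_left _ _)) hA
    have hnb1 : nb ≤ n := le_trans (le_trans (le_max_right _ _) (le_max_left _ _)) hA
    have hnd' : nd ≤ n := le_trans (le_max_right _ _) hA
    have hnc' : nc ≤ n := by have := le_trans (le_max_right _ _) hn; omega
    have hnc'' : nc ≤ n - 1 := by have := le_trans (le_max_right _ _) hn; omega
    have hgain := hnd n hnd'
    rw [pow_zero, mul_one] at hgain
    have hn1 : 1 ≤ n := by omega
    have hnR : (1 : ℝ) ≤ n := by exact_mod_cast hn1
    have hn0 : (0 : ℝ) < n := by linarith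
    have hf0 : (0 : ℝ) < n.factorial := by exact_mod_cast n.factorial_pos
    rw [hQe n hnc']
    -- the extremal triple at `n`
    obtain ⟨S, T, U, hTPP, hvol⟩ := (hP n).2.1
    by_cases hcase : (P n : ℝ) * (n : ℝ) ^ C₁ ≤ (n.factorial : ℝ) ^ ((3 : ℝ) / 2)
    · -- no violator: `Q n ≥ n^{C₁}`
      refine le_trans (min_le_left _ _) ?_
      rw [one_mul, le_div_iff₀ (hP0 n), mul_comm]
      exact hcase
    · -- a violator: purify and fibre
      rw [not_le] at hcase
      refine le_trans (min_le_right _ _) ?_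
      obtain ⟨S', hS'S, hS'p, hS'c⟩ := exists_signPure_half S
      obtain ⟨T', hT'T, hT'p, hT'c⟩ := exists_signPure_half T
      obtain ⟨U', hU'U, hU'p, hU'c⟩ := exists_signPure_half U
      have hTPP' : TripleProductProperty S' T' U' := hTPP.mono hS'S hT'T hU'U
      have hvolpos : 0 < S.card * T.card * U.card := by rw [hvol]; exact (hP n).2.2
      have hSpos : 0 < S.card := Nat.pos_of_mul_pos_right (Nat.pos_of_mul_pos_right hvolpos)
      have hTpos : 0 < T.card := Nat.pos_of_mul_pos_left (Nat.pos_of_mul_pos_right hvolpos)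
      have hUpos : 0 < U.card := Nat.pos_of_mul_pos_left hvolpos
      have hS'0 : S'.Nonempty := Finset.card_pos.1 (by omega)
      have hT'0 : T'.Nonempty := Finset.card_pos.1 (by omega)
      have hU'0 : U'.Nonempty := Finset.card_pos.1 (by omega)
      have h8 : ((S.card * T.card * U.card : ℕ) : ℝ) ≤ 8 * (S'.card * T'.card * U'.card : ℕ) := by
        have : S.card * T.card * U.card ≤ 8 * (S'.card * T'.card * U'.card) := by
          calc S.card * T.card * U.card ≤ (2 * S'.card) * (2 * T'.card) * (2 * U'.card) :=
                Nat.mul_le_mul (Nat.mul_le_mul hS'c hT'c) hU'c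
            _ = 8 * (S'.card * T'.card * U'.card) := by ring
        exact_mod_cast this
      -- the purified volume `N'` and `F = n!√(n!)/N' ≤ 8 n^{C₁} ≤ 8 n`
      have hN'0 : (0 : ℝ) < (S'.card * T'.card * U'.card : ℕ) := by
        exact_mod_cast Nat.mul_pos (Nat.mul_pos hS'0.card_pos hT'0.card_pos) hU'0.card_pos
      have hviol : (n.factorial : ℝ) * Real.sqrt (n.factorial : ℝ) ≤
          8 * (S'.card * T'.card * U'.card : ℕ) * (n : ℝ) ^ C₁ := by
        rw [← factorial_rpow_three_halves]
        have h1 : (n.factorial : ℝ) ^ ((3 : ℝ) / 2) ≤ (P n : ℝ) * (n : ℝ) ^ C₁ := hcase.le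
        rw [← hvol] at h1
        have h2 : ((S.card * T.card * U.card : ℕ) : ℝ) * (n : ℝ) ^ C₁ ≤
            8 * (S'.card * T'.card * U'.card : ℕ) * (n : ℝ) ^ C₁ :=
          mul_le_mul_of_nonneg_right h8 (by positivity)
        linarith
      have hF0 : 0 < (n.factorial : ℝ) * Real.sqrt (n.factorial : ℝ) / (S'.card * T'.card * U'.card : ℕ) := by
        positivity
      have hFle : (n.factorial : ℝ) * Real.sqrt (n.factorial : ℝ) / (S'.card * T'.card * U'.card : ℕ) ≤
          8 * (n : ℝ) ^ C₁ := by
        rw [div_le_iff₀ hN'0]; linarith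
      have hF8 : (n.factorial : ℝ) * Real.sqrt (n.factorial : ℝ) / (S'.card * T'.card * U'.card : ℕ) ≤
          8 * n := by
        refine hFle.trans ?_
        have h := Real.rpow_le_rpow_of_exponent_le hnR hC₁1
        rw [Real.rpow_one] at h
        linarith
      -- the side conditions at this `n` and this `F`
      obtain ⟨h40, _, _, hM3, _⟩ := hna n hna' _ hF0 hFle
      obtain ⟨hranges, hFblock⟩ := hnb n hnb1
      obtain ⟨hsmall₁, hFq⟩ := hFblock _ hF0 hFle
      obtain ⟨hr1, hr2, hr3, hr4, hr5, hr6, hr7, hr8⟩ := hranges _ _ _ _ _ _ _ _ _ _ _ _ _ _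
        rfl rfl rfl rfl rfl rfl rfl rfl rfl rfl rfl rfl rfl rfl
      have hn2 : 2 ≤ n := by omega
      have hn40R : (40 : ℝ) ≤ n := by exact_mod_cast h40
      have hm0 : (0 : ℝ) < (n : ℝ) - 1 := by linarith
      have hG1 : (1 : ℝ) ≤ 1 + Real.log n := by linarith [Real.log_nonneg hnR]
      -- the Frobenius floor: `F ≥ √(n-1)/2`, hence `M ≥ 1`
      have hfloor := frobenius_floor h40 hTPP' hS'0 hT'0 hU'0 hS'p hT'p hU'p
      have hpin := pinningError_le hn2 _ hN'0
      have hFlow : Real.sqrt ((n : ℝ) - 1) / 2 ≤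
          (n.factorial : ℝ) * Real.sqrt (n.factorial : ℝ) / (S'.card * T'.card * U'.card : ℕ) := by
        refine le_trans ?_ hfloor
        have hs0 : 0 ≤ Real.sqrt ((n : ℝ) - 1) := Real.sqrt_nonneg _
        have h1 : (1 / 2 : ℝ) ≤ 1 - ((n.factorial : ℝ) / (2 * (S'.card * T'.card * U'.card : ℕ)) +
            (n.factorial : ℝ) * Real.sqrt (n.factorial : ℝ) /
              (2 * (S'.card * T'.card * U'.card : ℕ) * Real.sqrt (((n * (n - 1) : ℕ) : ℝ) / 6))) := by
          linarith
        calc Real.sqrt ((n : ℝ) - 1) / 2 = (1 / 2) * Real.sqrt ((n : ℝ) - 1) := by ring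
          _ ≤ _ := mul_le_mul_of_nonneg_right h1 hs0
      have hM1 : (1 : ℝ) ≤ 10 ^ 34 * (1 + Real.log n) ^ 18 *
          ((n.factorial : ℝ) * Real.sqrt (n.factorial : ℝ) / (S'.card * T'.card * U'.card : ℕ)) ^ 2 /
            ((n : ℝ) - 1) := by
        rw [le_div_iff₀ hm0, one_mul]
        have hs2 : ((n : ℝ) - 1) / 4 ≤
            ((n.factorial : ℝ) * Real.sqrt (n.factorial : ℝ) / (S'.card * T'.card * U'.card : ℕ)) ^ 2 := by
          have h0 : 0 ≤ Real.sqrt ((n : ℝ) - 1) / 2 := by positivity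
          have h1 := pow_le_pow_left₀ h0 hFlow 2
          rw [div_pow, Real.sq_sqrt hm0.le] at h1
          linarith
        have hG18 : (1 : ℝ) ≤ (1 + Real.log n) ^ 18 := one_le_pow₀ hG1
        have hsq0 : 0 ≤ ((n.factorial : ℝ) * Real.sqrt (n.factorial : ℝ) /
            (S'.card * T'.card * U'.card : ℕ)) ^ 2 := sq_nonneg _
        have h2 : ((n.factorial : ℝ) * Real.sqrt (n.factorial : ℝ) / (S'.card * T'.card * U'.card : ℕ)) ^ 2 ≤
            (1 + Real.log n) ^ 18 *
              ((n.factorial : ℝ) * Real.sqrt (n.factorial : ℝ) / (S'.card * T'.card * U'.card : ℕ)) ^ 2 := by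
          have := mul_le_mul_of_nonneg_right hG18 hsq0; linarith
        nlinarith [h2, hs2]
      -- the trichotomy structure theorem
      have hstruct := pure_violator_volume_le_trichotomy h40 (P (n - 1)) (hP (n - 1)).1 hTPP' hS'0 hT'0
        hU'0 hS'p hT'p hU'p _ (2 * C₁) hM1 (by linarith) hM3 hF8 hsmall₁ (by linarith [hFq])
        _ _ _ _ _ _ _ _ _ _ _ _ _ _ rfl rfl rfl rfl rfl rfl rfl rfl rfl rfl rfl rfl rfl rfl
        hr1 hr2 hr3 hr4 hr5 hr6 hr7 hr8
      -- `P n ≤ 8 N' ≤ n^{3/2-1/400} P(n-1)`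
      have hPn1 : 0 ≤ (P (n - 1) : ℝ) := (hP0 (n - 1)).le
      have hmain : (P n : ℝ) ≤ (n : ℝ) ^ ((3 : ℝ) / 2 - 1 / 400) * P (n - 1) := by
        rw [← hvol]
        have h1 := mul_le_mul_of_nonneg_left hstruct (by norm_num : (0 : ℝ) ≤ 8)
        have h2 := mul_le_mul_of_nonneg_right hgain hPn1
        calc ((S.card * T.card * U.card : ℕ) : ℝ) ≤ 8 * (S'.card * T'.card * U'.card : ℕ) := h8
          _ ≤ _ := h1
          _ = 8 * (n : ℝ) ^ (1495 / 1000 : ℝ) * P (n - 1) := by ring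
          _ ≤ (n : ℝ) ^ ((3 : ℝ) / 2 - 1 / 400) * P (n - 1) := h2
      -- translate to `Q`
      rw [hQe (n - 1) hnc'']
      have hfac : (n.factorial : ℝ) ^ ((3 : ℝ) / 2) =
          (n : ℝ) ^ ((3 : ℝ) / 2) * ((n - 1).factorial : ℝ) ^ ((3 : ℝ) / 2) := by
        rw [← Real.mul_rpow hn0.le (Nat.cast_nonneg _)]
        congr 1
        have : n = (n - 1) + 1 := by omega
        conv_lhs => rw [this, Nat.factorial_succ]
        push_cast
        rw [Nat.cast_sub hn1]; ring
      have hsplit : (n : ℝ) ^ ((3 : ℝ) / 2) =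
          (n : ℝ) ^ (1 / 400 : ℝ) * (n : ℝ) ^ ((3 : ℝ) / 2 - 1 / 400) := by
        rw [← Real.rpow_add hn0]; congr 1; ring
      rw [hfac, hsplit]
      have hpow0 : 0 < (n : ℝ) ^ ((3 : ℝ) / 2 - 1 / 400) := Real.rpow_pos_of_pos hn0 _
      have hpowκ : 0 < (n : ℝ) ^ (1 / 400 : ℝ) := Real.rpow_pos_of_pos hn0 _
      rw [le_div_iff₀ (hP0 n)]
      calc (n : ℝ) ^ (1 / 400 : ℝ) * (((n - 1).factorial : ℝ) ^ ((3 : ℝ) / 2) / P (n - 1)) * P n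
          ≤ (n : ℝ) ^ (1 / 400 : ℝ) * (((n - 1).factorial : ℝ) ^ ((3 : ℝ) / 2) / P (n - 1)) *
            ((n : ℝ) ^ ((3 : ℝ) / 2 - 1 / 400) * P (n - 1)) :=
            mul_le_mul_of_nonneg_left hmain (by positivity)
        _ = (n : ℝ) ^ (1 / 400 : ℝ) * (n : ℝ) ^ ((3 : ℝ) / 2 - 1 / 400) *
            ((n - 1).factorial : ℝ) ^ ((3 : ℝ) / 2) := by
            have hP' := (hP0 (n - 1)).ne'
            field_simp
  /- the induction -/
  obtain ⟨n₂, hn₂⟩ := eventually_le_of_min_le Q 1 C₁ (1 / 400) one_pos (by norm_num) n₁ hQ1 hstep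
  refine ⟨max n₂ (max nc 1), fun n hn S T U hTPP => ?_⟩
  have hn2' : n₂ ≤ n := le_trans (le_max_left _ _) hn
  have hnc' : nc ≤ n := le_trans (le_trans (le_max_left _ _) (le_max_right _ _)) hn
  have hn1 : 1 ≤ n := le_trans (le_trans (le_max_right _ _) (le_max_right _ _)) hn
  have hnR : (1 : ℝ) ≤ n := by exact_mod_cast hn1
  have h := hn₂ n hn2'
  rw [one_mul, hQe n hnc', le_div_iff₀ (hP0 n)] at h
  have hvol : ((S.card * T.card * U.card : ℕ) : ℝ) ≤ P n := by exact_mod_cast (hP n).1 S T U hTPP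
  have hCC : (n : ℝ) ^ C ≤ (n : ℝ) ^ C₁ := Real.rpow_le_rpow_of_exponent_le hnR hCC₁
  calc ((S.card * T.card * U.card : ℕ) : ℝ) * (n : ℝ) ^ C ≤ (P n : ℝ) * (n : ℝ) ^ C₁ :=
        mul_le_mul hvol hCC (by positivity) (hP0 n).le
    _ = (n : ℝ) ^ C₁ * P n := mul_comm _ _
    _ ≤ (n.factorial : ℝ) ^ ((3 : ℝ) / 2) := h

end Summit.MatrixMultiplication.MatrixMultiplication.Theorems.PolynomialSlack
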